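import Literature.NumberTheory.Automorphic.PlaneLatticesCompanionAffineStrata          -- (P5c) I: affine norm condition, strata, re-centring (this seat)
import Literature.NumberTheory.LocalFields.UnramifiedQuadraticNormQuadraticCount      -- ★ `natCard_antifixed_quotient_pow`
import HarnessLib

/-!
# Self-dual companion-stable plane lattices with an EISENSTEIN (affine) CENTRE, II: the COUNT — `q^k` in the stratum `k ≤ j`, total `Σ_{k ≤ j} q^k` — the
# `|2| = 1`-free twin of ★ (β2′-ii) `PlaneLatticesCompanionSelfDualCount` (Flicker 1998, p. 97; Serre, Local Fields, Ch. V §2)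

Topic `NumberTheory/Automorphic`; namespace `Literature.NumberTheory.Automorphic`.  THEOREMS ONLY (no definition, no instance, no notation, no named fact,
no `sorry`).  Cell `pub/hodgecm-mathlib`, LH4 price list (P5c-i) «SELF-DUAL COUNT `P_j`, AFFINE CENTRE» (dealer LH4-plan (g6) WORD #70∕#85∕14:57Z rulings (R1)(R2);
M6 memo B-p08 (g40) §2(e)∕§4 row «B-p10″»; FRAME half F0P3a-p02 (g22) (P5d), whose `#S(!![0, β; σβ, 0], γ′)` docks into the head below by `rw`; consumers
F0P3a-p09 (g9) (P5f) `V = P_j`, F0P3b-p01 (g18) (P5g)).  Seat LH5-p01 (g5).  HONEST LABEL: HC_CM is proved only modulo the printed citations (hLiu418 =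
stmt-HodgeConjecture-24832, h413 = stmt-HodgeConjecture-24833) until rung 0 closes; this file is unconditional, elementary and count-neutral.

THE COUNT.  Under the affine datum `(a, f, e′)` of part I (`a ∈ 𝒪`, `|f| ≤ |ϖ^{j+1}|` SHARP, `|e′| = |ϖ^{2j+1}|`, `(C − a·1)² = f·(C − a·1) + e′·1`) and the
twisted-trace condition, the self-dual `C`-stable Hermite lattices of the stratum `k ≤ j` are parametrised by `y(x) = u⁻¹x − ϖ^{−(k+e)}a` (`u = σ(ϖ^{−e}β)`, `x ∈ 𝒪`
mod `𝔪^k`): stability reads `y′ ≡ −a (𝔪^{k+e})` (part I §1) and self-duality `β·σy′ + σβ·y′ ∈ 𝔪^{2k+2e}` reads `x + σx ∈ 𝔪^k` once `β·σa + σβ·a = 0` — so the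
stratum is the set of anti-fixed classes mod `𝔪^k` (`q^k` of them, ★ `natCard_antifixed_quotient_pow`), exactly as in ★ (β2′-ii) with `2⁻¹` deleted.  The HEAD takes
the WEAK bound `|β·σa + σβ·a| ≤ |ϖ^{j+1+e}|` (ruling (R2): what the rescaled cyclic frame delivers; tame rows give `0` via `a = t∕2`) and re-centres by part I §3 —
the LHS set does not see the centre.  With `a := t∕2`, `f := 0`, `e′ := (t² − 4d)∕4` (when `|2| = 1`) both statements specialise to ★ (β2′-ii) (`j = N`).

* §1 `ncard_stratum_antidiag_companion_eq_natCard_antifixed_affine` — stratum `k ≤ j` ↔ anti-fixed classes mod `𝔪^k` (exact twisted-trace centre).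
* §2 `ncard_selfDualStable_antidiag_companion_affine_eq_sum` — `#S(!![0, β; σβ, 0], C) = Σ_{k ≤ j} q^k` (LHS set = ★ (β2′-ii)'s, token for token; weak bound).

## References
* [Flicker1998UnitaryFL] Y. Z. Flicker, *The unitary fundamental lemma* (1998), §6 p. 95 REMARK, p. 97 (the type-(2) lattice count).
* [Serre1979] J.-P. Serre, *Local Fields*, GTM 67 (1979), Ch. I §6 (Eisenstein polynomials), Ch. V §2 (unramified trace).
-/

set_option autoImplicit false

noncomputable section

open scoped ValuativeRel Matrix MatrixGroups
open Matrix ValuativeRel Finset IsLocalRing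

namespace Literature.NumberTheory.Automorphic

/-! ## §1 The stratum `k ≤ j` ↔ anti-fixed classes mod `𝔪^k` -/

section Count

variable {F : Type*} [Field F] [ValuativeRel F] {ϖ : F} (hϖ : IsUniformizingElement ϖ) (σ : F →+* F)
  [IsDiscreteValuationRing 𝒪[F]]
  (σO : 𝒪[F] →+* 𝒪[F]) (hσO' : ∀ x : 𝒪[F], ((σO x : 𝒪[F]) : F) = σ x) (hσσ : ∀ x, σO (σO x) = x)
  (hσϖ : σ ϖ = ϖ) (hσv : ∀ x, valuation F (σ x) = valuation F x)
  {t d β : F} (hd : valuation F d = 1) {e : ℕ} (he : e ≤ 1) (hβ : valuation F β = valuation F (ϖ ^ e))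
  {j : ℕ} (γ : GL (Fin 2) F) (hγ : (γ : Matrix (Fin 2) (Fin 2) F) = !![0, -d; 1, t])

include hϖ hσO' hσσ hσϖ hσv hd he hβ hγ in
/-- **THE STRATUM `k ≤ j` ↔ ANTI-FIXED CLASSES mod `𝔪^k` (affine centre)**: the self-dual (`!![0, β; σβ, 0]`) `C(t,d)`-stable Hermite lattices `Λ(T(k, y, −k−e))`
are in bijection with `{x̄ ∈ 𝒪 ⧸ 𝔪^k : σ̄ x̄ = −x̄}` via `y = σ(β₁)⁻¹ x − ϖ^{−(k+e)} a`, `β₁ = ϖ^{−e}β`: stability reads `y′ ≡ −a (𝔪^{k+e})` (§1) and self-duality reads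
`β·σy′ + σβ·y′ ∈ 𝔪^{2k+2e}`, i.e. (using `β·σa + σβ·a = 0`) `x + σx ∈ 𝔪^k`. [cite: Flicker1998UnitaryFL, §6 p. 97] [cite: Serre1979, Ch. V §2] -/
theorem ncard_stratum_antidiag_companion_eq_natCard_antifixed_affine {a f e' : F} (haO : a ∈ 𝒪[F])
    (hf : valuation F f ≤ valuation F (ϖ ^ (j + 1))) (hj : valuation F e' = valuation F (ϖ ^ (2 * j + 1)))
    (htf : t - 2 * a = f) (hde : a * a - t * a + d = -e') (hβa : β * σ a + σ β * a = 0) {k : ℕ} (hkj : k ≤ j) :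
    {Λ : Submodule 𝒪[F] (Fin 2 → F) | ∃ (y : F) (g : GL (Fin 2) F), (g : Matrix (Fin 2) (Fin 2) F) = !![ϖ ^ (k : ℤ), y; 0, ϖ ^ (-(k : ℤ) - e)] ∧
        (∃ J' ∈ glInt 2 F, (J' : Matrix (Fin 2) (Fin 2) F) = formCongr σ g (!![0, β; σ β, 0] : Matrix (Fin 2) (Fin 2) F)) ∧
        (Submodule.span 𝒪[F] (Set.range ((g : Matrix (Fin 2) (Fin 2) F))ᵀ)).map ((Matrix.toLin' (γ : Matrix (Fin 2) (Fin 2) F)).restrictScalars 𝒪[F]) =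
          Submodule.span 𝒪[F] (Set.range ((g : Matrix (Fin 2) (Fin 2) F))ᵀ) ∧
        Λ = Submodule.span 𝒪[F] (Set.range ((g : Matrix (Fin 2) (Fin 2) F))ᵀ)}.ncard =
      Nat.card {x : 𝒪[F] ⧸ maximalIdeal 𝒪[F] ^ k //
        Ideal.quotientMap (maximalIdeal 𝒪[F] ^ k) σO (LocalFields.UnramifiedQuadraticNorm.maximalIdeal_pow_le_comap σO hσσ k) x = -x} := by
  classical
  have h0 := hϖ.ne_zero
  have hfO : f ∈ 𝒪[F] := (Valuation.mem_integer_iff _ _).2 (hf.trans ((Valuation.mem_integer_iff _ _).1 ((𝒪[F]).pow_mem hϖ.mem _)))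
  have ht : t ∈ 𝒪[F] := by
    rw [show t = a + a + f by linear_combination htf]; exact (𝒪[F]).add_mem ((𝒪[F]).add_mem haO haO) hfO
  have hσO : ∀ x : 𝒪[F], σ x ∈ 𝒪[F] := fun x => by rw [← hσO' x]; exact (σO x).2
  have hσσF : ∀ x : 𝒪[F], σ (σ (x : F)) = x := fun x => by
    have := congrArg (fun y : 𝒪[F] => (y : F)) (hσσ x); rwa [hσO', hσO'] at this
  have hdetT : ∀ y : F, (!![ϖ ^ (k : ℤ), y; 0, ϖ ^ (-(k : ℤ) - e)] : Matrix (Fin 2) (Fin 2) F).det ≠ 0 := fun y => by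
    rw [Matrix.det_fin_two_of, mul_zero, sub_zero]; exact mul_ne_zero (zpow_ne_zero _ h0) (zpow_ne_zero _ h0)
  -- the unit `u = σ(β₁)`, `β₁ = ϖ^{-e} β ∈ 𝒪^×`
  have hβ1v : valuation F (ϖ ^ (-(e : ℤ)) * β) = 1 := by
    rw [map_mul, hβ, ← map_mul, ← zpow_natCast, ← zpow_add₀ h0, neg_add_cancel, zpow_zero, map_one]
  have hβ1O : ϖ ^ (-(e : ℤ)) * β ∈ 𝒪[F] := (Valuation.mem_integer_iff _ _).2 hβ1v.le
  have hβ0 : β ≠ 0 := fun h => by rw [h, mul_zero, map_zero] at hβ1v; exact zero_ne_one hβ1v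
  have hσβ0 : σ β ≠ 0 := (map_ne_zero σ).2 hβ0
  set u : F := σ (ϖ ^ (-(e : ℤ)) * β) with hu
  have hue : u = ϖ ^ (-(e : ℤ)) * σ β := by rw [hu, map_mul, map_zpow₀, hσϖ]
  have huv : valuation F u = 1 := by rw [hu, hσv]; exact hβ1v
  have hu0 : u ≠ 0 := fun h => by rw [h, map_zero] at huv; exact zero_ne_one huv
  have huO : u ∈ 𝒪[F] := (Valuation.mem_integer_iff _ _).2 huv.le
  have huiO : u⁻¹ ∈ 𝒪[F] := (Valuation.mem_integer_iff _ _).2 (by rw [map_inv₀, huv, inv_one])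
  have hσu : σ u = ϖ ^ (-(e : ℤ)) * β := by rw [hu]; exact hσσF ⟨_, hβ1O⟩
  have hσa : β * σ a = -(σ β * a) := by linear_combination hβa
  -- the parametrisation `x ↦ y(x) = u⁻¹ x − ϖ^{−(k+e)} a`
  set yOf : F → F := fun x => u⁻¹ * x - ϖ ^ (-((k + e : ℕ) : ℤ)) * a with hyOf
  -- (F1) `y′ = ϖ^{k+e} y` and `ϖ^{-(k+e)}(y′ + a) = u⁻¹ x`
  have hF1 : ∀ x : F, ϖ ^ (-((k + e : ℕ) : ℤ)) * (ϖ ^ (-(-(k : ℤ) - e)) * yOf x + a) = u⁻¹ * x := fun x => by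
    rw [hyOf]
    have : (ϖ : F) ^ (-(-(k : ℤ) - e)) = (ϖ ^ (-((k + e : ℕ) : ℤ)))⁻¹ := by rw [← _root_.zpow_neg]; congr 1; push_cast; ring
    rw [this]; field_simp; ring
  have hF1' : ∀ x : F, x ∈ 𝒪[F] → ϖ ^ (-(-(k : ℤ) - e)) * yOf x ∈ 𝒪[F] := fun x hx => by
    have : ϖ ^ (-(-(k : ℤ) - e)) * yOf x = ϖ ^ ((k + e : ℕ) : ℤ) * (u⁻¹ * x) - a := by
      rw [hyOf]
      have e1 : (ϖ : F) ^ (-(-(k : ℤ) - e)) = ϖ ^ ((k + e : ℕ) : ℤ) := by congr 1; push_cast; ring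
      have e2 : (ϖ : F) ^ ((k + e : ℕ) : ℤ) * ϖ ^ (-((k + e : ℕ) : ℤ)) = 1 := by rw [← zpow_add₀ h0, add_neg_cancel, zpow_zero]
      rw [e1]
      calc ϖ ^ ((k + e : ℕ) : ℤ) * (u⁻¹ * x - ϖ ^ (-((k + e : ℕ) : ℤ)) * a)
          = ϖ ^ ((k + e : ℕ) : ℤ) * (u⁻¹ * x) - (ϖ ^ ((k + e : ℕ) : ℤ) * ϖ ^ (-((k + e : ℕ) : ℤ))) * a := by ring
        _ = _ := by rw [e2, one_mul]
    rw [this]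
    exact (𝒪[F]).sub_mem ((𝒪[F]).mul_mem ((zpow_uniformizer_mem_integer_iff hϖ _).2 (by positivity)) ((𝒪[F]).mul_mem huiO hx)) haO
  -- (F2) the twisted trace: `β σy + σβ y = ϖ^e (x + σx)` (uses `β σa + σβ a = 0`)
  have hF2 : ∀ x : F, β * σ (yOf x) + σ β * yOf x = ϖ ^ (e : ℤ) * (x + σ x) := fun x => by
    rw [hyOf]
    simp only [map_mul, map_sub, map_inv₀, hσu, map_zpow₀, hσϖ]
    rw [hue]
    have hβi : (ϖ ^ (-(e : ℤ)) * β)⁻¹ = ϖ ^ (e : ℤ) * β⁻¹ := by rw [mul_inv, ← _root_.zpow_neg, neg_neg]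
    have hσβi : (ϖ ^ (-(e : ℤ)) * σ β)⁻¹ = ϖ ^ (e : ℤ) * (σ β)⁻¹ := by rw [mul_inv, ← _root_.zpow_neg, neg_neg]
    rw [hβi, hσβi]
    calc β * (ϖ ^ (e : ℤ) * β⁻¹ * σ x - ϖ ^ (-((k + e : ℕ) : ℤ)) * σ a) + σ β * (ϖ ^ (e : ℤ) * (σ β)⁻¹ * x - ϖ ^ (-((k + e : ℕ) : ℤ)) * a)
        = ϖ ^ (e : ℤ) * (β * β⁻¹) * σ x + ϖ ^ (e : ℤ) * (σ β * (σ β)⁻¹) * x - ϖ ^ (-((k + e : ℕ) : ℤ)) * (β * σ a + σ β * a) := by ring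
      _ = ϖ ^ (e : ℤ) * (x + σ x) := by rw [mul_inv_cancel₀ hβ0, mul_inv_cancel₀ hσβ0, hβa]; ring
  -- (F3) for `x ∈ 𝒪`: the lattice `Λ(T(k, y(x), −k−e))` is `C`-stable, and self-dual iff `x̄` is anti-fixed
  have hF3st : ∀ (x : F) (hx : x ∈ 𝒪[F]) (g : GL (Fin 2) F), (g : Matrix (Fin 2) (Fin 2) F) = !![ϖ ^ (k : ℤ), yOf x; 0, ϖ ^ (-(k : ℤ) - e)] →
      (Submodule.span 𝒪[F] (Set.range ((g : Matrix (Fin 2) (Fin 2) F))ᵀ)).map ((Matrix.toLin' (γ : Matrix (Fin 2) (Fin 2) F)).restrictScalars 𝒪[F]) =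
        Submodule.span 𝒪[F] (Set.range ((g : Matrix (Fin 2) (Fin 2) F))ᵀ) := fun x hx g hg => by
    refine (map_companion_span_eq_self_iff_of_hermite hϖ γ g hγ hd ht hg).2 ⟨by omega, hF1' x hx, ?_⟩
    rw [(companion_rescale_identities h0 (k := k) (e := e) rfl (yOf x) t d β (σ β) (σ (yOf x))).1]
    exact (affine_norm_condition_iff hϖ hf hj htf hde he _).2 ⟨hkj, by rw [hF1 x]; exact (𝒪[F]).mul_mem huiO hx⟩
  have hF3sd : ∀ (x : 𝒪[F]) (g : GL (Fin 2) F), (g : Matrix (Fin 2) (Fin 2) F) = !![ϖ ^ (k : ℤ), yOf x; 0, ϖ ^ (-(k : ℤ) - e)] →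
      ((∃ J' ∈ glInt 2 F, (J' : Matrix (Fin 2) (Fin 2) F) = formCongr σ g (!![0, β; σ β, 0] : Matrix (Fin 2) (Fin 2) F)) ↔
        (Ideal.quotientMap (maximalIdeal 𝒪[F] ^ k) σO (LocalFields.UnramifiedQuadraticNorm.maximalIdeal_pow_le_comap σO hσσ k)) (Ideal.Quotient.mk (maximalIdeal 𝒪[F] ^ k) x) = -Ideal.Quotient.mk (maximalIdeal 𝒪[F] ^ k) x) := fun x g hg => by
    rw [exists_mem_glInt_coe_eq_formCongr_hermite_antidiag_iff σ hϖ hσϖ hσv g hg]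
    have hv1 : valuation F (β * ϖ ^ ((k : ℤ) + (-(k : ℤ) - e))) = 1 := by
      rw [show (k : ℤ) + (-(k : ℤ) - e) = -(e : ℤ) by ring, mul_comm]; exact hβ1v
    simp only [hv1, true_and]
    rw [hF2]
    -- `ϖ^{-k-e} (ϖ^e (x + σx)) = ϖ^{-k} (x + σx)`
    have e1 : (ϖ : F) ^ (-(k : ℤ) - e) * (ϖ ^ (e : ℤ) * ((x : F) + σ x)) = ϖ ^ (-(k : ℤ)) * (((x + σO x : 𝒪[F]) : F) - ((0 : 𝒪[F]) : F)) := by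
      rw [Subring.coe_add, hσO', Subring.coe_zero, sub_zero, show (-(k : ℤ) - e) = -(k : ℤ) + -(e : ℤ) by ring, zpow_add₀ h0]
      have : (ϖ : F) ^ (-(e : ℤ)) * ϖ ^ (e : ℤ) = 1 := by rw [← zpow_add₀ h0, neg_add_cancel, zpow_zero]
      calc ϖ ^ (-(k : ℤ)) * ϖ ^ (-(e : ℤ)) * (ϖ ^ (e : ℤ) * ((x : F) + σ x))
          = ϖ ^ (-(k : ℤ)) * (ϖ ^ (-(e : ℤ)) * ϖ ^ (e : ℤ)) * ((x : F) + σ x) := by ring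
        _ = _ := by rw [this, mul_one]
    rw [e1, zpow_neg_mul_coe_sub_mem_iff_mk_eq_mk hϖ k, map_zero, map_add, ← eq_neg_iff_add_eq_zero]
    have : (Ideal.quotientMap (maximalIdeal 𝒪[F] ^ k) σO (LocalFields.UnramifiedQuadraticNorm.maximalIdeal_pow_le_comap σO hσσ k)) (Ideal.Quotient.mk (maximalIdeal 𝒪[F] ^ k) x) = Ideal.Quotient.mk (maximalIdeal 𝒪[F] ^ k) (σO x) := Ideal.quotientMap_mk
    rw [this]
    constructor
    · intro h; rw [h, neg_neg]
    · intro h; rw [h, neg_neg]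
  -- lifts of residue classes
  have hlift : ∀ x : 𝒪[F] ⧸ (maximalIdeal 𝒪[F] ^ k), ∃ z : 𝒪[F], Ideal.Quotient.mk (maximalIdeal 𝒪[F] ^ k) z = x := fun x => Ideal.Quotient.mk_surjective x
  choose lift hlift using hlift
  -- `y(x₁) − y(x₂) = u⁻¹ (x₁ − x₂)`
  have hydiff : ∀ x₁ x₂ : F, yOf x₁ - yOf x₂ = u⁻¹ * (x₁ - x₂) := fun x₁ x₂ => by rw [hyOf]; ring
  have hcongr : ∀ x₁ x₂ : 𝒪[F], ϖ ^ (-(k : ℤ)) * (yOf x₁ - yOf x₂) ∈ 𝒪[F] ↔ Ideal.Quotient.mk (maximalIdeal 𝒪[F] ^ k) x₁ = Ideal.Quotient.mk (maximalIdeal 𝒪[F] ^ k) x₂ := fun x₁ x₂ => by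
    rw [← zpow_neg_mul_coe_sub_mem_iff_mk_eq_mk hϖ k, hydiff]
    constructor
    · intro h
      have : ϖ ^ (-(k : ℤ)) * ((x₁ : F) - x₂) = (ϖ ^ (-(k : ℤ)) * (u⁻¹ * ((x₁ : F) - x₂))) * u := by field_simp
      rw [this]
      exact (𝒪[F]).mul_mem h huO
    · intro h
      have : ϖ ^ (-(k : ℤ)) * (u⁻¹ * ((x₁ : F) - x₂)) = (ϖ ^ (-(k : ℤ)) * ((x₁ : F) - x₂)) * u⁻¹ := by ring
      rw [this]
      exact (𝒪[F]).mul_mem h huiO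
  -- THE BIJECTION
  change _ = Nat.card ({x : 𝒪[F] ⧸ (maximalIdeal 𝒪[F] ^ k) | (Ideal.quotientMap (maximalIdeal 𝒪[F] ^ k) σO (LocalFields.UnramifiedQuadraticNorm.maximalIdeal_pow_le_comap σO hσσ k)) x = -x} : Set (𝒪[F] ⧸ (maximalIdeal 𝒪[F] ^ k)))
  rw [Nat.card_coe_set_eq]
  symm
  refine Set.ncard_congr
    (fun x _ => Submodule.span 𝒪[F] (Set.range
      (!![ϖ ^ (k : ℤ), yOf (lift x); 0, ϖ ^ (-(k : ℤ) - e)] : Matrix (Fin 2) (Fin 2) F)ᵀ)) ?_ ?_ ?_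
  · -- into the stratum
    intro x hx
    have hgx : ((Matrix.GeneralLinearGroup.mkOfDetNeZero _ (hdetT (yOf (lift x))) : GL (Fin 2) F) : Matrix (Fin 2) (Fin 2) F) =
        !![ϖ ^ (k : ℤ), yOf (lift x); 0, ϖ ^ (-(k : ℤ) - e)] := Matrix.GeneralLinearGroup.val_mkOfDetNeZero _ _
    exact ⟨yOf (lift x), _, hgx, (hF3sd (lift x) _ hgx).2 (by rw [hlift]; exact hx), hF3st (lift x) (lift x).2 _ hgx, by rw [hgx]⟩
  · -- injective
    intro x x' hx hx' hxx'
    have hgx : ((Matrix.GeneralLinearGroup.mkOfDetNeZero _ (hdetT (yOf (lift x))) : GL (Fin 2) F) : Matrix (Fin 2) (Fin 2) F) =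
        !![ϖ ^ (k : ℤ), yOf (lift x); 0, ϖ ^ (-(k : ℤ) - e)] := Matrix.GeneralLinearGroup.val_mkOfDetNeZero _ _
    have hgx' : ((Matrix.GeneralLinearGroup.mkOfDetNeZero _ (hdetT (yOf (lift x'))) : GL (Fin 2) F) : Matrix (Fin 2) (Fin 2) F) =
        !![ϖ ^ (k : ℤ), yOf (lift x'); 0, ϖ ^ (-(k : ℤ) - e)] := Matrix.GeneralLinearGroup.val_mkOfDetNeZero _ _
    obtain ⟨-, -, h3⟩ := (span_eq_span_iff_of_hermite hϖ _ _ hgx hgx').1 (by rw [hgx, hgx']; exact hxx')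
    rw [← hlift x, ← hlift x']
    exact ((hcongr _ _).1 h3).symm
  · -- surjective
    rintro Λ ⟨y, g, hg, hsd, hst, rfl⟩
    -- `z := ϖ^{-(k+e)}(y′ + a) ∈ 𝒪`, `x := u z`, `y = yOf x`
    obtain ⟨-, -, hnorm⟩ := (map_companion_span_eq_self_iff_of_hermite hϖ γ g hγ hd ht hg).1 hst
    rw [(companion_rescale_identities h0 (k := k) (e := e) rfl y t d β (σ β) (σ y)).1] at hnorm
    obtain ⟨-, hz⟩ := (affine_norm_condition_iff hϖ hf hj htf hde he _).1 hnorm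
    set z : F := ϖ ^ (-((k + e : ℕ) : ℤ)) * (ϖ ^ (-(-(k : ℤ) - e)) * y + a) with hz'
    have hxO : u * z ∈ 𝒪[F] := (𝒪[F]).mul_mem huO hz
    have hyx : yOf (u * z) = y := by
      rw [hyOf, hz']
      have e1 : (ϖ : F) ^ (-(-(k : ℤ) - e)) = (ϖ ^ (-((k + e : ℕ) : ℤ)))⁻¹ := by rw [← _root_.zpow_neg]; congr 1; push_cast; ring
      rw [e1]; field_simp; ring
    refine ⟨Ideal.Quotient.mk (maximalIdeal 𝒪[F] ^ k) ⟨_, hxO⟩, ?_, ?_⟩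
    · -- anti-fixed, from self-duality
      have := (hF3sd ⟨_, hxO⟩ g (by rw [hg]; simp only [hyx])).1 hsd
      exact this
    · -- the same lattice
      have hgx : ((Matrix.GeneralLinearGroup.mkOfDetNeZero _ (hdetT (yOf (lift (Ideal.Quotient.mk (maximalIdeal 𝒪[F] ^ k) ⟨_, hxO⟩)))) :
          GL (Fin 2) F) : Matrix (Fin 2) (Fin 2) F) = !![ϖ ^ (k : ℤ), yOf (lift (Ideal.Quotient.mk (maximalIdeal 𝒪[F] ^ k) ⟨_, hxO⟩)); 0, ϖ ^ (-(k : ℤ) - e)] :=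
        Matrix.GeneralLinearGroup.val_mkOfDetNeZero _ _
      rw [← hgx]
      refine span_eq_span_of_hermite_of_sub_mem hϖ _ g hgx hg ?_
      rw [show y = yOf ((⟨u * z, hxO⟩ : 𝒪[F]) : F) from hyx.symm]
      exact (hcongr _ _).2 (hlift _).symm

/-! ## §2 The total count -/

include hϖ hσO' hσσ hσϖ hσv hd he hβ hγ in
/-- **THE TYPE-(2) H-SIDE LATTICE COUNT WITH AN EISENSTEIN CENTRE**: `#S(!![0, β; σβ, 0], C(t, d)) = Σ_{k=0}^{j} q^k`, `|𝓀| = q²`, `σ` moving an integer by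
a unit — ★ (β2′-ii) `ncard_selfDualStable_antidiag_companion_eq_sum` with `(|2| = 1, |t² − 4d| = |ϖ^{2N+1}|, βσt + σβt = 0)` replaced by the affine relation at
the integer centre `a`, `|f| ≤ |ϖ^{j+1}|`, `|e′| = |ϖ^{2j+1}|` and the WEAK twisted-trace bound `|βσa + σβa| ≤ |ϖ^{j+1+e}|` (what the rescaled cyclic frame
delivers; at a tame place `a = t∕2` gives `0`); the LHS set is ★ (β2′-ii)'s token for token.  Re-centre to `βσa₁ + σβa₁ = 0` (`exists_recentre_twistedTrace_eq_zero`), then the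
strata `k ≤ j` (§2) are disjoint (★ Hermite uniqueness) with `q^k` elements (§3 + ★ `natCard_antifixed_quotient_pow`). [cite: Flicker1998UnitaryFL, §6 p. 95 REMARK, p. 97] [cite: Serre1979, Ch. V §2] -/
theorem ncard_selfDualStable_antidiag_companion_affine_eq_sum {a f e' : F} (haO : a ∈ 𝒪[F])
    (hf : valuation F f ≤ valuation F (ϖ ^ (j + 1))) (hj : valuation F e' = valuation F (ϖ ^ (2 * j + 1)))
    (hγa : ((γ : Matrix (Fin 2) (Fin 2) F) - a • (1 : Matrix (Fin 2) (Fin 2) F)) * ((γ : Matrix (Fin 2) (Fin 2) F) - a • (1 : Matrix (Fin 2) (Fin 2) F)) =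
      f • ((γ : Matrix (Fin 2) (Fin 2) F) - a • (1 : Matrix (Fin 2) (Fin 2) F)) + e' • (1 : Matrix (Fin 2) (Fin 2) F))
    (hβa' : valuation F (β * σ a + σ β * a) ≤ valuation F (ϖ ^ (j + 1 + e)))
    {a₀ : 𝒪[F]} (ha₀ : IsUnit (σO a₀ - a₀)) {q : ℕ} [Finite (ResidueField 𝒪[F])] (hq : Nat.card (ResidueField 𝒪[F]) = q ^ 2) :
    {Λ : Submodule 𝒪[F] (Fin 2 → F) |
        (∃ g : GL (Fin 2) F, (∃ J' ∈ glInt 2 F, (J' : Matrix (Fin 2) (Fin 2) F) = formCongr σ g (!![0, β; σ β, 0] : Matrix (Fin 2) (Fin 2) F)) ∧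
          Λ = Submodule.span 𝒪[F] (Set.range ((g : Matrix (Fin 2) (Fin 2) F))ᵀ)) ∧
        Λ.map ((Matrix.toLin' (γ : Matrix (Fin 2) (Fin 2) F)).restrictScalars 𝒪[F]) = Λ}.ncard = ∑ k ∈ range (j + 1), q ^ k := by
  classical
  have hσO : ∀ x : 𝒪[F], σ x ∈ 𝒪[F] := fun x => by rw [← hσO' x]; exact (σO x).2
  obtain ⟨htf, hde⟩ := companion_affine_entries γ hγ hγa
  obtain ⟨a₁, f₁, e₁, ha₁O, hf₁, hj₁, htf₁, hde₁, hβa₁, -⟩ :=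
    exists_recentre_twistedTrace_eq_zero hϖ σ σO hσO' hσσ hσv hβ ha₀ haO hf hj htf hde hβa'
  -- the strata
  set T : ℕ → Set (Submodule 𝒪[F] (Fin 2 → F)) := fun k =>
    {Λ | ∃ (y : F) (g : GL (Fin 2) F), (g : Matrix (Fin 2) (Fin 2) F) = !![ϖ ^ (k : ℤ), y; 0, ϖ ^ (-(k : ℤ) - e)] ∧
        (∃ J' ∈ glInt 2 F, (J' : Matrix (Fin 2) (Fin 2) F) = formCongr σ g (!![0, β; σ β, 0] : Matrix (Fin 2) (Fin 2) F)) ∧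
        (Submodule.span 𝒪[F] (Set.range ((g : Matrix (Fin 2) (Fin 2) F))ᵀ)).map ((Matrix.toLin' (γ : Matrix (Fin 2) (Fin 2) F)).restrictScalars 𝒪[F]) =
          Submodule.span 𝒪[F] (Set.range ((g : Matrix (Fin 2) (Fin 2) F))ᵀ) ∧
        Λ = Submodule.span 𝒪[F] (Set.range ((g : Matrix (Fin 2) (Fin 2) F))ᵀ)} with hT
  have hval : ∀ k ∈ range (j + 1), (T k).ncard = q ^ k := fun k hk => by
    rw [hT]
    exact (ncard_stratum_antidiag_companion_eq_natCard_antifixed_affine hϖ σ σO hσO' hσσ hσϖ hσv hd he hβ γ hγ ha₁O hf₁ hj₁ htf₁ hde₁ hβa₁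
      (Nat.lt_succ_iff.1 (Finset.mem_range.1 hk))).trans (LocalFields.UnramifiedQuadraticNorm.natCard_antifixed_quotient_pow σO hσσ ha₀ hq k)
  have hq1 : 1 ≤ q := by
    rcases Nat.eq_zero_or_pos q with rfl | h
    · rw [zero_pow two_ne_zero] at hq; exact absurd hq (Nat.card_pos (α := ResidueField 𝒪[F])).ne'
    · exact h
  have hfin : ∀ k ∈ range (j + 1), (T k).Finite := fun k hk =>
    Set.finite_of_ncard_ne_zero (by rw [hval k hk]; exact pow_ne_zero _ (by omega))
  set U : Finset (Submodule 𝒪[F] (Fin 2 → F)) := (range (j + 1)).attach.biUnion fun k => (hfin k.1 k.2).toFinset with hU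
  have hSU : {Λ : Submodule 𝒪[F] (Fin 2 → F) |
        (∃ g : GL (Fin 2) F, (∃ J' ∈ glInt 2 F, (J' : Matrix (Fin 2) (Fin 2) F) = formCongr σ g (!![0, β; σ β, 0] : Matrix (Fin 2) (Fin 2) F)) ∧
          Λ = Submodule.span 𝒪[F] (Set.range ((g : Matrix (Fin 2) (Fin 2) F))ᵀ)) ∧
        Λ.map ((Matrix.toLin' (γ : Matrix (Fin 2) (Fin 2) F)).restrictScalars 𝒪[F]) = Λ} = (U : Set (Submodule 𝒪[F] (Fin 2 → F))) := by
    ext Λ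
    rw [mem_selfDualStable_antidiag_companion_iff_affine hϖ σ hσϖ hσv hσO haO hd he hβ hf hj γ hγ hγa Λ, hU, Finset.coe_biUnion]
    simp only [Finset.mem_coe, Finset.mem_attach, Set.iUnion_true, Set.mem_iUnion, Set.Finite.coe_toFinset]
    constructor
    · rintro ⟨k, hk, y, g, hg, hsd, hst, hΛ⟩
      refine ⟨⟨k, Finset.mem_range.2 (Nat.lt_succ_of_le hk)⟩, ?_⟩
      rw [hT]; exact ⟨y, g, hg, hsd, hst, hΛ⟩
    · rintro ⟨⟨k, hk⟩, hmem⟩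
      rw [hT] at hmem
      obtain ⟨y, g, hg, hsd, hst, hΛ⟩ := hmem
      exact ⟨k, Nat.lt_succ_iff.1 (Finset.mem_range.1 hk), y, g, hg, hsd, hst, hΛ⟩
  have hdisj : (↑(range (j + 1)).attach : Set {k // k ∈ range (j + 1)}).PairwiseDisjoint fun k => (hfin k.1 k.2).toFinset := by
    rintro ⟨k, hk⟩ - ⟨k', hk'⟩ - hne
    rw [Function.onFun, Set.Finite.disjoint_toFinset, Set.disjoint_left]
    rintro Λ hΛ hΛ'
    rw [hT] at hΛ hΛ'
    obtain ⟨y, g, hg, -, -, hΛg⟩ := hΛ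
    obtain ⟨y', g', hg', -, -, hΛg'⟩ := hΛ'
    have h1 := ((span_eq_span_iff_of_hermite hϖ g g' hg hg').1 (hΛg.symm.trans hΛg')).1
    exact hne (Subtype.ext (by exact_mod_cast h1))
  rw [hSU, Set.ncard_coe_finset, hU, Finset.card_biUnion hdisj, ← Finset.sum_attach (range (j + 1))]
  refine Finset.sum_congr rfl fun k _ => ?_
  rw [← Set.ncard_eq_toFinset_card _ (hfin k.1 k.2), hval k.1 k.2]

end Count

end Literature.NumberTheory.Automorphic

end
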